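import Literature.Analysis.FluidPDE.OnsagerBDSVSchauderHigher
import Literature.Analysis.FluidPDE.OnsagerBDSVPotentialTheoryProofs
import Literature.Analysis.FunctionSpaces.TorusLiftDerivBounds
import HarnessLib

/-!
# The Leray projection of the divergence of a smooth symmetric tensor on `T³`, with all-orders
# sup bounds through the Hölder–Zygmund scale (the estimate of `v̄_k` in Coiculescu–Palasek, Prop. 3.13)

Analysis/FluidPDE support file (definitions with proved API; no named facts) on the discharge path of
the principal-parts hypothesis `hA` of
`Literature.Barriers.NavierStokesRegularity.CriticalDataSmoothNonuniqueness_of_principalParts_of_perturbationLe`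
(M. P. Coiculescu, S. Palasek, *Non-uniqueness of smooth solutions of the Navier–Stokes equations from
critical data*, Invent. Math. 244 (2025), arXiv:2503.14699). The inverse-cascade blocks of **Def. 3.10**
are `v̄_k(t) = ½N_{k+1}⁻² ℙ div ∑_j A_{j,k+1}|η_j|²e^{-2|η_j|²N_{k+1}²t} a²_{j,k+1} θ_j ⊗ θ_j` — the Leray
projection `ℙ` of the divergence of a smooth symmetric tensor field — and the proof of **Prop. 3.13**
estimates them with a Hölder loss: "For `v̄_k`, one runs into the difficulty that `ℙ` is not bounded on
`L^∞`. Instead, we carry out the estimate in the Hölder space `C^{β₁}` … By (cutoffbounds), (abounds),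
and (psidatabounds), `‖∇ᵐv̄_k‖_{L^∞} ≲ ‖∇ᵐv̄_k‖_{C^{β₁}} ≲ N_k^{1+β₁+m} e^{-N_{k+1}²t}`. Note that the
homogeneous `C^{β₁}` norm controls `L^∞` in this case because `v̄_k` has zero average on `𝕋³`."

This file provides that step for a general smooth tensor field `G : T³ → ℝ^{3×3}` (Pi type, rows first):

* `CP25.tensorDiv G` — `(div G)_i = ∑_j ∂_j G_{ij}` (the same formula as `CoiculescuPalasek2025.matrixDiv`);
* `CP25.lerayTensorDiv G` — **`ℙ div G`**, written as `div G - (∑_a ∂_c∂_aΔ⁻¹ (div G)_a)_c` through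
  the tree's second Riesz transforms `BDSV.rieszHessian c a` (so that `ℙ u = u - ∇Δ⁻¹ div u` on the
  mean-zero field `u = div G`); it is smooth, divergence free (`∑_c ∂_c∂_c Δ⁻¹ = Id - mean`,
  `BDSV.sum_rieszHessian_diag`) and has zero mean;
* `CP25.hasLiftDerivBounds_lerayTensorDiv` — **the all-orders bound with Hölder loss**: for `0 < α < 1`
  and every `n` there is `K` (depending on `α, n` only) such that `HasLiftDerivBounds (n+2) G C L` with
  `1 ≤ L` implies `HasLiftDerivBounds n (ℙ div G) (K C L^{1+α}) L` — i.e. `‖∇ᵐ ℙ div G‖_∞ ≲_m C L^{1+α+m}`,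
  one derivative for `div` and the loss `L^α` (BDSV App. C Prop. C.1 in all orders,
  `BDSV.holderCZBound.rieszHessian_le`, fed with the `C^{N,α}` norm computed from the derivative bounds,
  `eContDiffHolderNorm_le_of_norm_iteratedFDeriv_le`);
* the conversions between the currencies used on the way: `CP25.eContDiffHolderNorm_le_of_hasLiftDerivBounds`
  (`‖h‖_{C^{N,α}} ≤ (N+4) C L^{N+α}` from `HasLiftDerivBounds (N+1) h C L`, `L ≥ 1`) and
  `CP25.norm_iteratedFDeriv_lift_le_of_eContDiffHolderNorm_le`.

## Mathlib / tree search

Tree: `BDSV.rieszHessian`, `BDSV.isSmooth_rieszHessian`, `BDSV.sum_rieszHessian_diag`,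
`BDSV.rieszHessian_eq_partialDeriv_invLaplacian_partialDeriv`, `BDSV.holderCZBound_holds`,
`BDSV.holderCZBound.rieszHessian_le` (`OnsagerBDSVPotentialTheory(Proofs)`, `OnsagerBDSVSchauderHigher`),
`eContDiffHolderNorm_le_of_norm_iteratedFDeriv_le` (`HolderInterpolation`),
`enorm_iteratedFDeriv_le_eContDiffHolderNorm` (`ContDiffHolderAlgebra`), `Torus.HasLiftDerivBounds`
(`TorusLiftDerivBounds`), `Torus.integral_partialDeriv_eq_zero_holds`. `lean search 'lerayTensorDiv|ℙ div .*tensor'`: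
the tree has Leray–Helmholtz as facts (`TorusLerayHelmholtz`) and on `L²` (`LerayProjector*`), not this
smooth-operator-with-Hölder-bounds form.

## References

* M. P. Coiculescu, S. Palasek, Invent. Math. 244 (2025) 165–219, arXiv:2503.14699: Def. 3.10 (`v̄_k`),
  Prop. 3.13 (proof, (vkbarbounds)), §2.3 ("`‖f‖_{L^∞} ≲ ‖f‖_{𝒞^s}` for zero-average `f`"). [CoiculescuPalasek2025]
* T. Buckmaster, C. De Lellis, L. Székelyhidi Jr., V. Vicol, CPAM 72 (2019), App. C Prop. C.1 (Hölder
  boundedness of periodic Calderón–Zygmund operators). [BuckmasterEtAl2018]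
-/

noncomputable section

open Set Function MeasureTheory Filter UnitAddTorus
open scoped BigOperators ContDiff Topology NNReal ENNReal

namespace Literature.Analysis.FluidPDE

namespace CP25

open Literature.Analysis.FunctionSpaces Literature.Analysis.FunctionSpaces.Torus

/-! ## The tensor divergence -/

/-- **The divergence of a tensor field** `G : T³ → ℝ^{3×3}` (rows first): `(div G)_i = ∑_j ∂_j G_{ij}`.
[cite: CoiculescuPalasek2025, §2.1 and Def. 3.10] -/
def tensorDiv (G : UnitAddTorus (Fin 3) → (Fin 3 → Fin 3 → ℝ)) (x : UnitAddTorus (Fin 3)) :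
    EuclideanSpace ℝ (Fin 3) :=
  WithLp.toLp 2 fun i => ∑ j, Torus.partialDeriv j (fun y => G y i j) x

/-- Coordinates of the tensor divergence. [folklore] -/
@[simp]
theorem tensorDiv_apply (G : UnitAddTorus (Fin 3) → (Fin 3 → Fin 3 → ℝ)) (x : UnitAddTorus (Fin 3)) (i : Fin 3) :
    tensorDiv G x i = ∑ j, Torus.partialDeriv j (fun y => G y i j) x := rfl

section TensorDiv

variable {n : ℕ} {G : UnitAddTorus (Fin 3) → (Fin 3 → Fin 3 → ℝ)} {C L : ℝ}

/-- **The tensor divergence in the currency**: from `HasLiftDerivBounds (n+1) G C L` (`L ≥ 0`),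
`HasLiftDerivBounds n (div G) (9 C L) L`. [folklore] -/
theorem hasLiftDerivBounds_tensorDiv (hG : HasLiftDerivBounds (n + 1) G C L) (hL : 0 ≤ L) :
    HasLiftDerivBounds n (tensorDiv G) (9 * (C * L)) L := by
  have hC := hG.nonneg
  -- each coordinate `∑_j ∂_j G_{ij}`
  have hcoord : ∀ i, HasLiftDerivBounds n (fun x => tensorDiv G x i) (3 * (C * L)) L := by
    intro i
    have hterm : ∀ j ∈ (Finset.univ : Finset (Fin 3)),
        HasLiftDerivBounds n (Torus.partialDeriv j fun y => G y i j) (C * L) L :=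
      fun j _ => ((hG.pi_apply i).pi_apply j).partialDeriv j
    have hs := HasLiftDerivBounds.sum Finset.univ hterm hL
    rw [Finset.sum_const, Finset.card_univ, Fintype.card_fin] at hs
    simp only [nsmul_eq_mul, Nat.cast_ofNat] at hs
    exact hs
  have h := HasLiftDerivBounds.euclidean_of_coord hcoord hL
  rw [Fintype.card_fin] at h
  refine ⟨h.isSmooth, fun i hi y => (h.bound hi y).trans (le_of_eq ?_)⟩
  push_cast; ring

/-- The tensor divergence of a smooth tensor is smooth. [folklore] -/
theorem isSmooth_tensorDiv (hG : IsSmooth G) : IsSmooth (tensorDiv G) := by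
  refine contDiff_euclidean.2 fun i => ?_
  have : (fun y => lift (tensorDiv G) y i) = lift fun x => ∑ j, Torus.partialDeriv j (fun y => G y i j) x := rfl
  rw [this]
  have hl : lift (fun x => ∑ j, Torus.partialDeriv j (fun y => G y i j) x) =
      fun y => ∑ j, lift (Torus.partialDeriv j fun y => G y i j) y := by funext y; simp [lift_apply]
  rw [hl]
  refine ContDiff.sum fun j _ => ?_
  have hij : IsSmooth fun y => G y i j := (contDiff_pi.1 ((contDiff_pi.1 hG) i)) j
  exact hij.partialDeriv j

/-- **The tensor divergence has zero mean** (each coordinate is a sum of partial derivatives). [folklore] -/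
theorem hasZeroMean_tensorDiv (hG : IsSmooth G) : Torus.HasZeroMean (tensorDiv G) := by
  unfold Torus.HasZeroMean
  have hint : Integrable (tensorDiv G) volume := (isSmooth_tensorDiv hG).continuous.integrable_unitAddTorus
  ext i
  have h := (EuclideanSpace.proj i : EuclideanSpace ℝ (Fin 3) →L[ℝ] ℝ).integral_comp_comm hint
  simp only [PiLp.zero_apply]
  rw [show (∫ x, tensorDiv G x) i = ∫ x, tensorDiv G x i by simpa using h.symm]
  simp only [tensorDiv_apply]
  have hij : ∀ j, IsSmooth fun y => G y i j := fun j => (contDiff_pi.1 ((contDiff_pi.1 hG) i)) j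
  rw [integral_finsetSum _ fun j _ => ((hij j).partialDeriv j).continuous.integrable_unitAddTorus]
  exact Finset.sum_eq_zero fun j _ => integral_partialDeriv_eq_zero_holds (hij j) j

end TensorDiv

/-! ## The Leray projection of a tensor divergence -/

/-- **`ℙ div G`** for a smooth tensor field `G`: `(ℙ div G)_c = (div G)_c - ∑_a ∂_c∂_aΔ⁻¹ (div G)_a`
(`ℙu = u - ∇Δ⁻¹ div u` on the mean-zero field `u = div G`, with `∇Δ⁻¹ div u` written through the second
Riesz transforms `∂_c∂_aΔ⁻¹`). [cite: CoiculescuPalasek2025, Def. 3.10 (`ℙ div`)] -/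
def lerayTensorDiv (G : UnitAddTorus (Fin 3) → (Fin 3 → Fin 3 → ℝ)) (x : UnitAddTorus (Fin 3)) :
    EuclideanSpace ℝ (Fin 3) :=
  tensorDiv G x - WithLp.toLp 2 fun c => ∑ a, BDSV.rieszHessian c a (fun y => tensorDiv G y a) x

/-- The gradient part `(∑_a ∂_c∂_aΔ⁻¹ u_a)_c` of the Leray projection, as a field. [folklore] -/
def rieszGradDiv (u : UnitAddTorus (Fin 3) → EuclideanSpace ℝ (Fin 3)) (x : UnitAddTorus (Fin 3)) :
    EuclideanSpace ℝ (Fin 3) :=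
  WithLp.toLp 2 fun c => ∑ a, BDSV.rieszHessian c a (fun y => u y a) x

/-- `ℙ div G = div G - rieszGradDiv (div G)`. [folklore] -/
theorem lerayTensorDiv_eq (G : UnitAddTorus (Fin 3) → (Fin 3 → Fin 3 → ℝ)) :
    lerayTensorDiv G = fun x => tensorDiv G x - rieszGradDiv (tensorDiv G) x := rfl

section Leray

variable {u : UnitAddTorus (Fin 3) → EuclideanSpace ℝ (Fin 3)} {G : UnitAddTorus (Fin 3) → (Fin 3 → Fin 3 → ℝ)}

/-- The gradient part is smooth. [folklore] -/
theorem isSmooth_rieszGradDiv (hu : IsSmooth u) : IsSmooth (rieszGradDiv u) := by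
  refine contDiff_euclidean.2 fun c => ?_
  have : (fun y => lift (rieszGradDiv u) y c) = fun y => ∑ a, lift (BDSV.rieszHessian c a fun z => u z a) y := by
    funext y; simp [rieszGradDiv, lift_apply]
  rw [this]
  exact ContDiff.sum fun a _ => BDSV.isSmooth_rieszHessian (hu.apply a) c a

/-- **`ℙ div G` is smooth.** [cite: CoiculescuPalasek2025, §5 ("`v⁽ⁱ⁾ ∈ C^∞`")] -/
theorem isSmooth_lerayTensorDiv (hG : IsSmooth G) : IsSmooth (lerayTensorDiv G) := by
  rw [lerayTensorDiv_eq]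
  exact (isSmooth_tensorDiv hG).sub (isSmooth_rieszGradDiv (isSmooth_tensorDiv hG))

/-- **The gradient part has zero mean** (each `∂_c∂_aΔ⁻¹f` is a partial derivative). [folklore] -/
theorem hasZeroMean_rieszGradDiv (hu : IsSmooth u) : Torus.HasZeroMean (rieszGradDiv u) := by
  unfold Torus.HasZeroMean
  have hint : Integrable (rieszGradDiv u) volume := (isSmooth_rieszGradDiv hu).continuous.integrable_unitAddTorus
  ext c
  have h := (EuclideanSpace.proj c : EuclideanSpace ℝ (Fin 3) →L[ℝ] ℝ).integral_comp_comm hint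
  simp only [PiLp.zero_apply]
  rw [show (∫ x, rieszGradDiv u x) c = ∫ x, rieszGradDiv u x c by simpa using h.symm]
  simp only [rieszGradDiv]
  rw [integral_finsetSum _ fun a _ => (BDSV.isSmooth_rieszHessian (hu.apply a) c a).continuous.integrable_unitAddTorus]
  refine Finset.sum_eq_zero fun a _ => ?_
  simp only [BDSV.rieszHessian]
  exact integral_partialDeriv_eq_zero_holds ((isSmooth_invLaplacian (hu.apply a)).partialDeriv a) c

/-- **`ℙ div G` has zero mean.** [cite: CoiculescuPalasek2025, Rmk. 3.11 with Def. 3.10] -/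
theorem hasZeroMean_lerayTensorDiv (hG : IsSmooth G) : Torus.HasZeroMean (lerayTensorDiv G) := by
  have h1 := hasZeroMean_tensorDiv hG
  have h2 := hasZeroMean_rieszGradDiv (isSmooth_tensorDiv hG)
  unfold Torus.HasZeroMean at h1 h2 ⊢
  rw [lerayTensorDiv_eq]
  rw [integral_sub (isSmooth_tensorDiv hG).continuous.integrable_unitAddTorus
    (isSmooth_rieszGradDiv (isSmooth_tensorDiv hG)).continuous.integrable_unitAddTorus, h1, h2, sub_zero]

/-- **The divergence of the gradient part is `div u`** for smooth mean-zero-divergence fields: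
`∑_c ∂_c ∑_a ∂_c∂_aΔ⁻¹ u_a = ∑_a ∂_a ΔΔ⁻¹ u_a = ∑_a ∂_a (u_a - ⨍u_a) = div u`. [folklore] -/
theorem divergence_rieszGradDiv (hu : IsSmooth u) (x : UnitAddTorus (Fin 3)) :
    Torus.divergence (rieszGradDiv u) x = Torus.divergence u x := by
  have hua : ∀ a, IsSmooth fun y => u y a := fun a => hu.apply a
  rw [divergence_eq_sum_partialDeriv_apply ((isSmooth_rieszGradDiv hu).isContDiff (by simp)),
    divergence_eq_sum_partialDeriv_apply (hu.isContDiff (by simp))]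
  -- coordinates of the partial derivatives of the gradient part
  have hcoord : ∀ c, Torus.partialDeriv c (rieszGradDiv u) x c =
      ∑ a, Torus.partialDeriv c (BDSV.rieszHessian c a fun y => u y a) x := by
    intro c
    rw [← partialDeriv_apply_coord ((isSmooth_rieszGradDiv hu).isContDiff (by simp)) c x c]
    have : (fun y => rieszGradDiv u y c) = fun y => ∑ a ∈ Finset.univ, (fun z => BDSV.rieszHessian c a (fun w => u w a) z) y := by
      funext y; simp [rieszGradDiv]
    rw [this, partialDeriv_finset_sum Finset.univ
      (fun a _ => (BDSV.isSmooth_rieszHessian (hua a) c a).isContDiff (by simp)) c x]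
  simp_rw [hcoord]
  rw [Finset.sum_comm]
  refine Finset.sum_congr rfl fun a _ => ?_
  -- `∑_c ∂_c ∂_c∂_aΔ⁻¹ u_a = ∑_c ∂_c∂_cΔ⁻¹ (∂_a u_a) = ∂_a u_a - ∫ ∂_a u_a = ∂_a u_a`
  have h1 : ∀ c, Torus.partialDeriv c (BDSV.rieszHessian c a fun y => u y a) x =
      BDSV.rieszHessian c c (Torus.partialDeriv a fun y => u y a) x := by
    intro c
    rw [BDSV.partialDeriv_rieszHessian (hua a)]
    -- `∂_c∂_aΔ⁻¹(∂_c f) = ∂_c∂_cΔ⁻¹(∂_a f)`: both are `Δ⁻¹ ∂_c∂_a∂_c f`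
    rw [BDSV.rieszHessian_eq_invLaplacian_partialDeriv_partialDeriv ((hua a).partialDeriv c),
      BDSV.rieszHessian_eq_invLaplacian_partialDeriv_partialDeriv ((hua a).partialDeriv a)]
    congr 1
    funext y
    have hin : Torus.partialDeriv a (Torus.partialDeriv c fun w => u w a) =
        Torus.partialDeriv c (Torus.partialDeriv a fun w => u w a) :=
      funext fun z => partialDeriv_comm (hua a) a c z
    rw [hin]
  simp_rw [h1]
  rw [BDSV.sum_rieszHessian_diag ((hua a).partialDeriv a), integral_partialDeriv_eq_zero_holds (hua a) a, sub_zero,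
    partialDeriv_apply_coord (hu.isContDiff (by simp)) a x a]

/-- **`ℙ div G` is divergence free.** [cite: CoiculescuPalasek2025, Prop. 3.13 ("`v̄_k` … inside of `ℙ`")] -/
theorem isDivFree_lerayTensorDiv (hG : IsSmooth G) : Torus.IsDivFree (lerayTensorDiv G) := by
  intro x
  have hu := isSmooth_tensorDiv hG
  rw [lerayTensorDiv_eq, show (fun x => tensorDiv G x - rieszGradDiv (tensorDiv G) x) = tensorDiv G - rieszGradDiv (tensorDiv G)
    from rfl, divergence_sub (hu.isContDiff (by simp)) ((isSmooth_rieszGradDiv hu).isContDiff (by simp)),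
    divergence_rieszGradDiv hu, sub_self]

end Leray

/-! ## Between the currencies: Hölder norms from derivative bounds, derivative bounds from Hölder norms -/

section Currency

variable {Y : Type*} [NormedAddCommGroup Y] [NormedSpace ℝ Y]
variable {N : ℕ} {h : UnitAddTorus (Fin 3) → Y} {C L : ℝ} {α : ℝ≥0}

/-- **The `C^{N,α}` norm from geometric derivative bounds**: `HasLiftDerivBounds (N+1) h C L` with `1 ≤ L`
and `α ≤ 1` gives `‖h‖_{C^{N,α}(T³)} ≤ (N+4) C L^N L^α` (interpolation at the scale `δ = L⁻¹`:
`Σ_{i≤N} C Lⁱ + C L^{N+1} δ^{1-α} + 2 C L^N δ^{-α} ≤ (N+1+3) C L^{N+α}`).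
[cite: CoiculescuPalasek2025, Prop. 3.13 (proof: "`‖∇ᵐv̄_k‖_{L^∞} ≲ ‖∇ᵐv̄_k‖_{C^{β₁}}`")] -/
theorem eContDiffHolderNorm_le_of_hasLiftDerivBounds (hh : HasLiftDerivBounds (N + 1) h C L) (hL : 1 ≤ L)
    (hα : α ≤ 1) :
    Torus.eContDiffHolderNorm N α h ≤ ENNReal.ofReal (((N : ℝ) + 4) * C * L ^ N * L ^ (α : ℝ)) := by
  have hC := hh.nonneg
  have hL0 : 0 < L := lt_of_lt_of_le one_pos hL
  have hb := eContDiffHolderNorm_le_of_norm_iteratedFDeriv_le (f := lift h) (k := N) hh.contDiff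
    (M := fun i => C * L ^ i) (fun i => by positivity) (fun i hi y => hh.bound hi y) hα (δ := L⁻¹) (by positivity)
  refine hb.trans (ENNReal.ofReal_le_ofReal ?_)
  -- compare the two real bounds
  have hLi : ∀ i ≤ N, L ^ i ≤ L ^ N := fun i hi => pow_le_pow_right₀ hL hi
  have hsum : ∑ i ∈ Finset.range (N + 1), C * L ^ i ≤ ((N : ℝ) + 1) * (C * L ^ N) := by
    calc ∑ i ∈ Finset.range (N + 1), C * L ^ i ≤ ∑ _i ∈ Finset.range (N + 1), C * L ^ N :=
          Finset.sum_le_sum fun i hi => mul_le_mul_of_nonneg_left (hLi i (Nat.lt_succ_iff.1 (Finset.mem_range.1 hi))) hC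
      _ = ((N : ℝ) + 1) * (C * L ^ N) := by simp [Finset.sum_const, Finset.card_range]
  have hLα : 1 ≤ L ^ (α : ℝ) := Real.one_le_rpow hL α.2
  -- `C L^{N+1} (L⁻¹)^{1-α} = C L^N L^α` and `2 C L^N (L⁻¹)⁻¹^α = 2 C L^N L^α`
  have h1 : C * L ^ (N + 1) * L⁻¹ ^ (1 - α : ℝ) = C * L ^ N * L ^ (α : ℝ) := by
    rw [Real.inv_rpow hL0.le, Real.rpow_sub hL0, Real.rpow_one, pow_succ]
    field_simp
  have h2 : 2 * (C * L ^ N) * L⁻¹⁻¹ ^ (α : ℝ) = 2 * (C * L ^ N * L ^ (α : ℝ)) := by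
    rw [inv_inv]; ring
  rw [h1, h2]
  have hP : 0 ≤ C * L ^ N * L ^ (α : ℝ) := by positivity
  have hQ : C * L ^ N ≤ C * L ^ N * L ^ (α : ℝ) := by
    calc C * L ^ N = C * L ^ N * 1 := (mul_one _).symm
      _ ≤ C * L ^ N * L ^ (α : ℝ) := mul_le_mul_of_nonneg_left hLα (by positivity)
  nlinarith

/-- **Derivative bounds from a Hölder norm**: `‖Dⁱ(g∘proj)(y)‖ ≤ B` for `i ≤ N` whenever
`‖g‖_{C^{N,α}(T³)} ≤ ofReal B` (`B ≥ 0`). [folklore] -/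
theorem norm_iteratedFDeriv_lift_le_of_eContDiffHolderNorm_le {g : UnitAddTorus (Fin 3) → Y} {B : ℝ} (hB : 0 ≤ B)
    (hg : Torus.eContDiffHolderNorm N α g ≤ ENNReal.ofReal B) {i : ℕ} (hi : i ≤ N) (y : EuclideanSpace ℝ (Fin 3)) :
    ‖iteratedFDeriv ℝ i (lift g) y‖ ≤ B := by
  have h := (enorm_iteratedFDeriv_le_eContDiffHolderNorm hi α (lift g) y).trans hg
  rw [← ofReal_norm] at h
  exact (ENNReal.ofReal_le_ofReal_iff hB).1 h

end Currency

/-! ## The all-orders bound for `ℙ div G` with Hölder loss -/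

section Bounds

variable {α : ℝ≥0}

/-- The Calderón–Zygmund constant of `∂_c∂_aΔ⁻¹` on `C^{N,α}(T³)` (BDSV Prop. C.1 in all orders,
`BDSV.holderCZBound.rieszHessian_le` with the proved `BDSV.holderCZBound_holds`), chosen once for each `N`.
[cite: BuckmasterEtAl2018, App. C Prop. C.1] -/
def czConst (α : ℝ≥0) (hα : 0 < α) (hα1 : α < 1) (N : ℕ) : ℝ≥0 :=
  Classical.choose (BDSV.holderCZBound_holds.rieszHessian_le hα hα1 N)

/-- The defining property of `czConst`. [cite: BuckmasterEtAl2018, App. C Prop. C.1] -/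
theorem czConst_spec (hα : 0 < α) (hα1 : α < 1) (N : ℕ) (c a : Fin 3) {f : UnitAddTorus (Fin 3) → ℝ} (hf : IsSmooth f) :
    Torus.eContDiffHolderNorm N α (BDSV.rieszHessian c a f) ≤ czConst α hα hα1 N * Torus.eContDiffHolderNorm N α f :=
  Classical.choose_spec (BDSV.holderCZBound_holds.rieszHessian_le hα hα1 N) c a f hf

/-- A running maximum `K_n ≥ 1` of the constants `(m+4) czConst(m)`, `m ≤ n`. [folklore] -/
def czConstSup (α : ℝ≥0) (hα : 0 < α) (hα1 : α < 1) : ℕ → ℝ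
  | 0 => max 1 (4 * czConst α hα hα1 0)
  | n + 1 => max (czConstSup α hα hα1 n) (((n : ℝ) + 1 + 4) * czConst α hα hα1 (n + 1))

/-- `1 ≤ K_n`. [folklore] -/
theorem one_le_czConstSup (hα : 0 < α) (hα1 : α < 1) (n : ℕ) : 1 ≤ czConstSup α hα hα1 n := by
  induction n with
  | zero => exact le_max_left _ _
  | succ n ih => exact ih.trans (le_max_left _ _)

/-- `(m+4) czConst(m) ≤ K_n` for `m ≤ n`. [folklore] -/
theorem mul_czConst_le_czConstSup (hα : 0 < α) (hα1 : α < 1) {m n : ℕ} (hmn : m ≤ n) :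
    ((m : ℝ) + 4) * czConst α hα hα1 m ≤ czConstSup α hα hα1 n := by
  induction n with
  | zero =>
    rw [Nat.le_zero.1 hmn]
    simp only [czConstSup, Nat.cast_zero, zero_add]
    exact le_max_right _ _
  | succ n ih =>
    rcases Nat.lt_or_ge m (n + 1) with hlt | hge
    · exact (ih (Nat.lt_succ_iff.1 hlt)).trans (le_max_left _ _)
    · rw [le_antisymm hmn hge]
      refine le_trans (le_of_eq ?_) (le_max_right _ _)
      push_cast; ring

/-- **One Riesz transform of a coordinate in the currency**: for a smooth vector field `u` with
`HasLiftDerivBounds (n+1) u C L`, `1 ≤ L`, `0 < α < 1`: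
`‖Dᵐ(∂_c∂_aΔ⁻¹ u_a ∘ proj)‖ ≤ K_n C L^α Lᵐ` for all `m ≤ n`. [cite: BuckmasterEtAl2018, App. C Prop. C.1] -/
theorem norm_iteratedFDeriv_lift_rieszHessian_le (hα : 0 < α) (hα1 : α < 1) {n : ℕ}
    {u : UnitAddTorus (Fin 3) → EuclideanSpace ℝ (Fin 3)} {C L : ℝ} (hu : HasLiftDerivBounds (n + 1) u C L)
    (hL : 1 ≤ L) (c a : Fin 3) {m : ℕ} (hm : m ≤ n) (y : EuclideanSpace ℝ (Fin 3)) :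
    ‖iteratedFDeriv ℝ m (lift (BDSV.rieszHessian c a fun z => u z a)) y‖ ≤
      czConstSup α hα hα1 n * C * L ^ (α : ℝ) * L ^ m := by
  have hua : HasLiftDerivBounds (m + 1) (fun z => u z a) C L := (hu.apply_coord a).of_le (by omega)
  have hC := hu.nonneg
  have hL0 : 0 < L := lt_of_lt_of_le one_pos hL
  -- `‖u_a‖_{C^{m,α}} ≤ (m+4) C L^m L^α`
  have hH := eContDiffHolderNorm_le_of_hasLiftDerivBounds hua hL hα1.le
  -- the CZ bound
  have hCZ := czConst_spec hα hα1 m c a hua.isSmooth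
  have hB0 : 0 ≤ ((m : ℝ) + 4) * C * L ^ m * L ^ (α : ℝ) := by positivity
  have hR : Torus.eContDiffHolderNorm m α (BDSV.rieszHessian c a fun z => u z a) ≤
      ENNReal.ofReal (czConst α hα hα1 m * (((m : ℝ) + 4) * C * L ^ m * L ^ (α : ℝ))) := by
    refine hCZ.trans ?_
    rw [ENNReal.ofReal_mul (NNReal.coe_nonneg _), ENNReal.ofReal_coe_nnreal]
    exact mul_le_mul' le_rfl hH
  have h := norm_iteratedFDeriv_lift_le_of_eContDiffHolderNorm_le (by positivity) hR le_rfl y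
  refine h.trans ?_
  have hK := mul_czConst_le_czConstSup hα hα1 hm
  have : 0 ≤ C * L ^ m * L ^ (α : ℝ) := by positivity
  calc (czConst α hα hα1 m : ℝ) * (((m : ℝ) + 4) * C * L ^ m * L ^ (α : ℝ))
      = (((m : ℝ) + 4) * czConst α hα hα1 m) * (C * L ^ m * L ^ (α : ℝ)) := by ring
    _ ≤ czConstSup α hα hα1 n * (C * L ^ m * L ^ (α : ℝ)) := mul_le_mul_of_nonneg_right hK this
    _ = czConstSup α hα hα1 n * C * L ^ (α : ℝ) * L ^ m := by ring

/-- **The gradient part in the currency**: `HasLiftDerivBounds n (rieszGradDiv u) (9 K_n C L^α) L` from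
`HasLiftDerivBounds (n+1) u C L`, `1 ≤ L`. [cite: BuckmasterEtAl2018, App. C Prop. C.1] -/
theorem hasLiftDerivBounds_rieszGradDiv (hα : 0 < α) (hα1 : α < 1) {n : ℕ}
    {u : UnitAddTorus (Fin 3) → EuclideanSpace ℝ (Fin 3)} {C L : ℝ} (hu : HasLiftDerivBounds (n + 1) u C L)
    (hL : 1 ≤ L) :
    HasLiftDerivBounds n (rieszGradDiv u) (9 * (czConstSup α hα hα1 n * C * L ^ (α : ℝ))) L := by
  have hL0 : 0 ≤ L := le_trans zero_le_one hL
  have hC := hu.nonneg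
  have hK0 : 0 ≤ czConstSup α hα hα1 n * C * L ^ (α : ℝ) := by
    have := one_le_czConstSup hα hα1 n; positivity
  have hterm : ∀ c, ∀ a ∈ (Finset.univ : Finset (Fin 3)),
      HasLiftDerivBounds n (BDSV.rieszHessian c a fun z => u z a) (czConstSup α hα hα1 n * C * L ^ (α : ℝ)) L :=
    fun c a _ => ⟨BDSV.isSmooth_rieszHessian (hu.isSmooth.apply a) c a, fun m hm y =>
      norm_iteratedFDeriv_lift_rieszHessian_le hα hα1 hu hL c a hm y⟩
  have hcoord : ∀ c, HasLiftDerivBounds n (fun x => rieszGradDiv u x c) (3 * (czConstSup α hα hα1 n * C * L ^ (α : ℝ))) L := by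
    intro c
    have hs := HasLiftDerivBounds.sum Finset.univ (hterm c) hL0
    rw [Finset.sum_const, Finset.card_univ, Fintype.card_fin] at hs
    simp only [nsmul_eq_mul, Nat.cast_ofNat] at hs
    exact hs
  have h := HasLiftDerivBounds.euclidean_of_coord hcoord hL0
  rw [Fintype.card_fin] at h
  refine ⟨h.isSmooth, fun i hi y => (h.bound hi y).trans (le_of_eq ?_)⟩
  push_cast; ring

/-- **`ℙ div G` in the currency, with Hölder loss** (the estimate (vkbarbounds) of Prop. 3.13): for
`0 < α < 1` and `n` there is `K = 90 K_n` such that `HasLiftDerivBounds (n+2) G C L` with `1 ≤ L` gives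
`HasLiftDerivBounds n (ℙ div G) (K C L L^α) L`, i.e. `‖Dᵐ ℙ div G‖_∞ ≤ 90 K_n C L^{1+α+m}` for `m ≤ n`.
[cite: CoiculescuPalasek2025, Prop. 3.13 (proof, estimate of `v̄_k` in `C^{β₁}`)] -/
theorem hasLiftDerivBounds_lerayTensorDiv (hα : 0 < α) (hα1 : α < 1) {n : ℕ}
    {G : UnitAddTorus (Fin 3) → (Fin 3 → Fin 3 → ℝ)} {C L : ℝ} (hG : HasLiftDerivBounds (n + 2) G C L) (hL : 1 ≤ L) :
    HasLiftDerivBounds n (lerayTensorDiv G) (90 * czConstSup α hα hα1 n * C * L * L ^ (α : ℝ)) L := by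
  have hL0 : 0 ≤ L := le_trans zero_le_one hL
  have hC := hG.nonneg
  have hK := one_le_czConstSup hα hα1 n
  have hLα : 1 ≤ L ^ (α : ℝ) := Real.one_le_rpow hL α.2
  have hdiv : HasLiftDerivBounds (n + 1) (tensorDiv G) (9 * (C * L)) L := hasLiftDerivBounds_tensorDiv hG hL0
  have hgrad := hasLiftDerivBounds_rieszGradDiv hα hα1 hdiv hL
  have hsub := (hdiv.of_le (Nat.le_succ n)).sub hgrad
  rw [lerayTensorDiv_eq]
  refine hsub.mono ?_ hL0 le_rfl
  -- `9CL + 9·K·9CL·L^α ≤ 90 K C L L^α`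
  have h1 : 9 * (C * L) ≤ 9 * czConstSup α hα hα1 n * C * L * L ^ (α : ℝ) := by
    have : 9 * (C * L) = 9 * 1 * C * L * 1 := by ring
    rw [this]; gcongr
  nlinarith [mul_nonneg (mul_nonneg hC hL0) (le_trans zero_le_one hLα)]

end Bounds

/-! ## Linearity over finite weighted sums of smooth tensors -/

section Linear

variable {ι : Type*} (s : Finset ι) (c : ι → ℝ)

/-- `∂ᵢ∂ⱼΔ⁻¹` of a finite weighted sum of smooth real functions. [folklore] -/
theorem rieszHessian_finset_sum_smul {f : ι → UnitAddTorus (Fin 3) → ℝ} (hf : ∀ i ∈ s, IsSmooth (f i))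
    (l a : Fin 3) (x : UnitAddTorus (Fin 3)) :
    BDSV.rieszHessian l a (fun y => ∑ i ∈ s, c i * f i y) x = ∑ i ∈ s, c i * BDSV.rieszHessian l a (f i) x := by
  classical
  induction s using Finset.induction_on with
  | empty => simp [BDSV.rieszHessian_zero, show (fun _ : UnitAddTorus (Fin 3) => (0 : ℝ)) = 0 from rfl]
  | insert i s hi ih =>
    have hf' : ∀ i' ∈ s, IsSmooth (f i') := fun i' hi' => hf i' (Finset.mem_insert_of_mem hi')
    have hfi : IsSmooth (f i) := hf i (Finset.mem_insert_self i s)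
    have hsmooth : IsSmooth (fun y => ∑ i' ∈ s, c i' * f i' y) := by
      show ContDiff ℝ ∞ (lift fun y => ∑ i' ∈ s, c i' * f i' y)
      have hl : lift (fun y => ∑ i' ∈ s, c i' * f i' y) = fun z => ∑ i' ∈ s, c i' * lift (f i') z := by
        funext z; simp [lift_apply]
      rw [hl]
      exact ContDiff.sum fun i' hi' => contDiff_const.mul (hf' i' hi')
    have hsplit : (fun y => ∑ i' ∈ insert i s, c i' * f i' y) = (c i • f i) + fun y => ∑ i' ∈ s, c i' * f i' y := by
      funext y; simp [Finset.sum_insert hi, smul_eq_mul]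
    rw [hsplit, BDSV.rieszHessian_add (hfi.smul (c i)) hsmooth, Pi.add_apply, BDSV.rieszHessian_const_smul hfi,
      Pi.smul_apply, smul_eq_mul, ih hf', Finset.sum_insert hi]

variable {Gi : ι → UnitAddTorus (Fin 3) → (Fin 3 → Fin 3 → ℝ)}

/-- The tensor divergence of a finite weighted sum of smooth tensors. [folklore] -/
theorem tensorDiv_finset_sum_smul (hG : ∀ i ∈ s, IsSmooth (Gi i)) (x : UnitAddTorus (Fin 3)) :
    tensorDiv (fun y a b => ∑ i ∈ s, c i * Gi i y a b) x = ∑ i ∈ s, c i • tensorDiv (Gi i) x := by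
  ext l
  simp only [tensorDiv_apply, WithLp.ofLp_sum, Finset.sum_apply, WithLp.ofLp_smul, Pi.smul_apply, smul_eq_mul]
  have hab : ∀ a b, ∀ i ∈ s, IsSmooth fun y => Gi i y a b :=
    fun a b i hi => (contDiff_pi.1 ((contDiff_pi.1 (hG i hi)) a)) b
  have h1 : ∀ j, Torus.partialDeriv j (fun y => ∑ i ∈ s, c i * Gi i y l j) x =
      ∑ i ∈ s, c i * Torus.partialDeriv j (fun y => Gi i y l j) x := by
    intro j
    have hsm : ∀ i ∈ s, IsSmooth fun z => c i * Gi i z l j := fun i hi => contDiff_const.mul (hab l j i hi)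
    rw [partialDeriv_finset_sum s (f := fun i z => c i * Gi i z l j) (fun i hi => (hsm i hi).isContDiff (by simp)) j x]
    refine Finset.sum_congr rfl fun i hi => ?_
    rw [show (fun z => c i * Gi i z l j) = c i • fun z => Gi i z l j from by funext z; simp [smul_eq_mul],
      partialDeriv_const_smul ((hab l j i hi).isContDiff (by simp))]
    simp [smul_eq_mul]
  simp_rw [h1]
  rw [Finset.sum_comm]
  refine Finset.sum_congr rfl fun i _ => ?_
  rw [Finset.mul_sum]

/-- The Riesz gradient part of a finite weighted sum of smooth fields. [folklore] -/
theorem rieszGradDiv_finset_sum_smul {ui : ι → UnitAddTorus (Fin 3) → EuclideanSpace ℝ (Fin 3)}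
    (hu : ∀ i ∈ s, IsSmooth (ui i)) (x : UnitAddTorus (Fin 3)) :
    rieszGradDiv (fun y => ∑ i ∈ s, c i • ui i y) x = ∑ i ∈ s, c i • rieszGradDiv (ui i) x := by
  ext l
  simp only [rieszGradDiv, WithLp.ofLp_sum, Finset.sum_apply, WithLp.ofLp_smul, Pi.smul_apply, smul_eq_mul]
  have hR : ∀ a, BDSV.rieszHessian l a (fun y => ∑ i ∈ s, c i * ui i y a) x =
      ∑ i ∈ s, c i * BDSV.rieszHessian l a (fun y => ui i y a) x :=
    fun a => rieszHessian_finset_sum_smul s c (fun i hi => (hu i hi).apply a) l a x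
  simp_rw [hR]
  rw [Finset.sum_comm]
  refine Finset.sum_congr rfl fun i _ => ?_
  rw [Finset.mul_sum]

/-- **Linearity of `ℙ div` over finite weighted sums of smooth tensors.** [folklore] -/
theorem lerayTensorDiv_finset_sum_smul (hG : ∀ i ∈ s, IsSmooth (Gi i)) (x : UnitAddTorus (Fin 3)) :
    lerayTensorDiv (fun y a b => ∑ i ∈ s, c i * Gi i y a b) x = ∑ i ∈ s, c i • lerayTensorDiv (Gi i) x := by
  rw [lerayTensorDiv_eq]
  show tensorDiv (fun y a b => ∑ i ∈ s, c i * Gi i y a b) x -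
      rieszGradDiv (tensorDiv fun y a b => ∑ i ∈ s, c i * Gi i y a b) x = _
  rw [tensorDiv_finset_sum_smul s c hG x]
  have h2 : rieszGradDiv (tensorDiv fun y a b => ∑ i ∈ s, c i * Gi i y a b) x =
      ∑ i ∈ s, c i • rieszGradDiv (tensorDiv (Gi i)) x := by
    rw [show tensorDiv (fun y a b => ∑ i ∈ s, c i * Gi i y a b) = fun y => ∑ i ∈ s, c i • tensorDiv (Gi i) y from
      funext fun y => tensorDiv_finset_sum_smul s c hG y]
    exact rieszGradDiv_finset_sum_smul s c (fun i hi => isSmooth_tensorDiv (hG i hi)) x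
  rw [h2, ← Finset.sum_sub_distrib]
  refine Finset.sum_congr rfl fun i _ => ?_
  rw [lerayTensorDiv_eq, smul_sub]

end Linear

end CP25

end Literature.Analysis.FluidPDE
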